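import Summits.QuantumFields.BalabanUV.Beta.EriceRemainderEnclosureHistoryAutonomyComparisonDualComparison

/-!
# EriceRemainderEnclosureHistoryAutonomyComparisonDualContractionLinks — (E138a) **BRICKS OF THE CONTRACTION CLASS**: (§1) a CONTRACTION LEMMA on real sequences —
# dual steps `X`, sources `E ≥ 0` non-increasing, an age profile `Λ ≥ 0` on `range K` with moment `θ = Σ_k k·Λ_k`, and the two LINK inequalities
# `E_n − X_n ≤ Σ_k Λ_k Σ_{l≤k} X⁺_{n+l}`, `X_n − E_n ≤ Σ_k Λ_k Σ_{l≤k} X⁻_{n+l}`: bounded violations `max(X⁻_n, X_n − E_n)` contract by `θ` (`link_contract`), so for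
# `θ < 1` they vanish, **`0 ≤ X_n ≤ E_n`** (`sandwich_of_links`); (§2) the flow bricks that feed it along ONE perturbed orbit `h′` with the base family `S` restarted at its
# points — levels grow by the floor from the pin (`level_ge_pin_add`, `tail_graded`: every orbit tail lies in the GRADED box `level_k ≥ 1∕γ² + (k+1)·b`), the dual step in
# level form (`dual_step_eq_levels`), SIGNED damping between two base orbits in either order (`base_level_gap_between`), and the WINDOW GAPS controlled by the signed
# parts of the dual steps with NO sign assumed (`gap_le_sum_parts`: `−Σ_{l≤k} X⁻_{n+l} ≤ 1∕h′_{n+1+k}² − 1∕(S h′_n)_{1+k}² ≤ Σ_{l≤k} X⁺_{n+l}`; (E132) `dual_gap_le_sum_steps`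
# is the case `X ≥ 0`).  The comparison theorem itself is (E138b) `…ComparisonDualContraction`.

Cell `pub-balaban`, β-function sub-cell, BINDER row D4 «RemainderConst leaves for Bałaban's split» (`HOME/BINDER-OWNERS.md`; owner lineage `b2b-balaban-beta-an4`;
this file by co-owner #2 lineage `b2b-balaban-beta-d4-p2`, generation 106), β-FLOW TEAM duty (1), FREEZE (0) honoured (def-free; (E132) `base_gap_damped`, (E48a)
`family_zero` ∕ `family_mem` ∕ `family_tail_eq` ∕ `le_of_pin_le` BY NAME; nothing restated).  Successor item (α″) of `HOME/b2b-balaban-beta-d4-p2/HANDOFF.gen105.md`.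

HONEST FRAMING (page 1, verbatim and binding).  *"Discharging BetaPertH makes Bałaban's UV stability UNCONDITIONAL — a real constructive-QFT result; it is
NOT the continuum limit and NOT the Clay problem."*  THIS FILE DISCHARGES NOTHING OF THE KIND.  Elementary real analysis about ABSTRACT functionals on a box
]0,γ]^ℕ (node U2's `MemFlow` ∕ `SeqBox`) and about real sequences — hypotheses of a census, not facts; nothing about Bałaban's (1.22) limit functional is PRINTED
in this form ([I] p. 298; GAPS G-t4-U2-1∕-2) or asserted.  Row D4 class UNCHANGED (critical-path width 0; instance 0∕1; D4 DISCHARGE NO DATE).  NOT B12 Thm 2, NOT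
BetaPertH, NOT continuum YM, NOT Clay.

WHAT IS PROVED ([folklore]; 0 `def`, 0 sorry).  §1 **`link_contract`**, **`sandwich_of_links`**.  §2 `level_ge_pin_add`, `tail_graded`, `dual_step_eq_levels`,
**`base_level_gap_between`**, **`gap_le_sum_parts`**.
-/
noncomputable section
open Finset Set

namespace Summit.QuantumFields.BalabanUV.Beta.EriceRemainderEnclosureHistoryAutonomyComparisonDualContractionLinks

open Literature.MathematicalPhysics.QuantumFieldTheory.Balaban1983to89
open Literature.MathematicalPhysics.QuantumFieldTheory.Balaban1983to89.T4BetaStationary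
open Literature.MathematicalPhysics.QuantumFieldTheory.Balaban1983to89.T4BetaFlowWellPosed
open Summit.QuantumFields.BalabanUV.Beta.EriceRemainderEnclosureHistoryAutonomyOrder
  (family_zero family_mem family_tail_eq le_of_pin_le)
open Summit.QuantumFields.BalabanUV.Beta.EriceRemainderEnclosureHistoryAutonomyComparisonDualOrbit (base_gap_damped)

/-! ## §1 The contraction lemma on sequences (no flows) -/

/-- **ONE LINK OF THE CONTRACTION.**  Sequences `X` (dual steps), `E ≥ 0` (sources, non-increasing), a profile `Λ ≥ 0` on `range K` with age moment
`θ = Σ_k k·Λ_k ≤ 1`, and the two LINK INEQUALITIES `E_n − X_n ≤ Σ_k Λ_k Σ_{l≤k} X⁺_{n+l}`, `X_n − E_n ≤ Σ_k Λ_k Σ_{l≤k} X⁻_{n+l}`.  If the violations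
`X⁻_m` and `X_m − E_m` are `≤ C` everywhere, they are `≤ θ·C` everywhere: a negative step is paid by positive parts of LATER steps in its window, which exceed
their own sources by at most `C` and those sources are below `E_n`; an overshoot is paid by negative parts of later steps. [folklore] -/
theorem link_contract {X E Λ : ℕ → ℝ} {K : ℕ} {C : ℝ}
    (hΛ : ∀ k, 0 ≤ Λ k) (hθ1 : ∑ k ∈ range K, (k : ℝ) * Λ k ≤ 1)
    (hE0 : ∀ n, 0 ≤ E n) (hEanti : ∀ n l, E (n + (l + 1)) ≤ E n)
    (hLm : ∀ n, E n - X n ≤ ∑ k ∈ range K, Λ k * ∑ l ∈ range (k + 1), max (X (n + l)) 0)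
    (hLp : ∀ n, X n - E n ≤ ∑ k ∈ range K, Λ k * ∑ l ∈ range (k + 1), max (-X (n + l)) 0)
    (hC : ∀ m, max (-X m) 0 ≤ C ∧ X m - E m ≤ C) (n : ℕ) :
    max (-X n) 0 ≤ (∑ k ∈ range K, (k : ℝ) * Λ k) * C ∧ X n - E n ≤ (∑ k ∈ range K, (k : ℝ) * Λ k) * C := by
  set θ : ℝ := ∑ k ∈ range K, (k : ℝ) * Λ k with hθ
  have hC0 : 0 ≤ C := (le_max_right _ _).trans (hC 0).1
  have hθ0 : 0 ≤ θ := sum_nonneg fun k _ => mul_nonneg (Nat.cast_nonneg k) (hΛ k)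
  have hθC : 0 ≤ θ * C := mul_nonneg hθ0 hC0
  -- the later positive parts in a window: each at most E n + C
  have hpos : ∀ l, max (X (n + (l + 1))) 0 ≤ E n + C := fun l =>
    max_le (by linarith [(hC (n + (l + 1))).2, hEanti n l]) (by linarith [hE0 n])
  have hneg : ∀ l, max (-X (n + (l + 1))) 0 ≤ C := fun l => (hC (n + (l + 1))).1
  -- split off the l = 0 term of each window sum
  have hwinP : ∀ k ∈ range K, Λ k * ∑ l ∈ range (k + 1), max (X (n + l)) 0 ≤ Λ k * max (X n) 0 + ((k : ℝ) * Λ k) * (E n + C) := by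
    intro k _
    rw [sum_range_succ', Nat.add_zero]
    have hs : ∑ l ∈ range k, max (X (n + (l + 1))) 0 ≤ ∑ l ∈ range k, (E n + C) := sum_le_sum fun l _ => hpos l
    rw [sum_const, card_range, nsmul_eq_mul] at hs
    nlinarith [hΛ k, hs]
  have hwinN : ∀ k ∈ range K, Λ k * ∑ l ∈ range (k + 1), max (-X (n + l)) 0 ≤ Λ k * max (-X n) 0 + ((k : ℝ) * Λ k) * C := by
    intro k _
    rw [sum_range_succ', Nat.add_zero]
    have hs : ∑ l ∈ range k, max (-X (n + (l + 1))) 0 ≤ ∑ l ∈ range k, C := sum_le_sum fun l _ => hneg l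
    rw [sum_const, card_range, nsmul_eq_mul] at hs
    nlinarith [hΛ k, hs]
  have hLm' : E n - X n ≤ (∑ k ∈ range K, Λ k) * max (X n) 0 + θ * (E n + C) := by
    refine (hLm n).trans ((sum_le_sum hwinP).trans_eq ?_)
    rw [sum_add_distrib, sum_mul, sum_mul]
  have hLp' : X n - E n ≤ (∑ k ∈ range K, Λ k) * max (-X n) 0 + θ * C := by
    refine (hLp n).trans ((sum_le_sum hwinN).trans_eq ?_)
    rw [sum_add_distrib, sum_mul, sum_mul]
  constructor
  · by_cases hX : 0 ≤ X n
    · rw [max_eq_right (by linarith)]; exact hθC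
    · have hX' : X n < 0 := lt_of_not_ge hX
      rw [max_eq_left (by linarith)]
      rw [max_eq_right hX'.le, mul_zero, zero_add] at hLm'
      nlinarith [hE0 n, hθ1]
  · by_cases hXE : X n ≤ E n
    · linarith
    · have hXE' : E n < X n := lt_of_not_ge hXE
      have hX0 : 0 ≤ X n := (hE0 n).trans hXE'.le
      rw [max_eq_right (by linarith), mul_zero, zero_add] at hLp'
      exact hLp'

/-- **THE CONTRACTION.**  Under the hypotheses of `link_contract` with STRICT age moment `θ < 1` and an initial bound `C₀` on the violations, all violations
vanish: `0 ≤ X_n ≤ E_n` at every `n` — iterate the link (`≤ θ^j·C₀` for every `j`) and let `j → ∞`.  No induction on the depth, no base case. [folklore] -/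
theorem sandwich_of_links {X E Λ : ℕ → ℝ} {K : ℕ} {C₀ : ℝ}
    (hΛ : ∀ k, 0 ≤ Λ k) (hθ : ∑ k ∈ range K, (k : ℝ) * Λ k < 1)
    (hE0 : ∀ n, 0 ≤ E n) (hEanti : ∀ n l, E (n + (l + 1)) ≤ E n)
    (hLm : ∀ n, E n - X n ≤ ∑ k ∈ range K, Λ k * ∑ l ∈ range (k + 1), max (X (n + l)) 0)
    (hLp : ∀ n, X n - E n ≤ ∑ k ∈ range K, Λ k * ∑ l ∈ range (k + 1), max (-X (n + l)) 0)
    (hC : ∀ m, max (-X m) 0 ≤ C₀ ∧ X m - E m ≤ C₀) (n : ℕ) :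
    0 ≤ X n ∧ X n ≤ E n := by
  set θ : ℝ := ∑ k ∈ range K, (k : ℝ) * Λ k with hθdef
  have hC0 : 0 ≤ C₀ := (le_max_right _ _).trans (hC 0).1
  have hθ0 : 0 ≤ θ := sum_nonneg fun k _ => mul_nonneg (Nat.cast_nonneg k) (hΛ k)
  have iter : ∀ j : ℕ, ∀ m, max (-X m) 0 ≤ θ ^ j * C₀ ∧ X m - E m ≤ θ ^ j * C₀ := by
    intro j
    induction j with
    | zero => simpa using hC
    | succ j ih =>
      intro m
      have h := link_contract hΛ hθ.le hE0 hEanti hLm hLp ih m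
      rw [pow_succ, mul_comm (θ ^ j) θ, mul_assoc]
      exact h
  -- the violations are below every θ^j·C₀, hence ≤ 0
  have hsmall : ∀ ε : ℝ, 0 < ε → ∃ j : ℕ, θ ^ j * C₀ < ε := by
    intro ε hε
    obtain ⟨j, hj⟩ := exists_pow_lt_of_lt_one (div_pos hε (by linarith : (0 : ℝ) < C₀ + 1)) hθ
    refine ⟨j, ?_⟩
    have h1 : θ ^ j * C₀ ≤ θ ^ j * (C₀ + 1) := mul_le_mul_of_nonneg_left (by linarith) (pow_nonneg hθ0 j)
    have h2 : θ ^ j * (C₀ + 1) < ε := by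
      have := (lt_div_iff₀ (by linarith : (0 : ℝ) < C₀ + 1)).mp hj
      linarith
    linarith
  constructor
  · by_contra hX
    have hX' : X n < 0 := lt_of_not_ge hX
    obtain ⟨j, hj⟩ := hsmall (-X n) (by linarith)
    have := (iter j n).1
    rw [max_eq_left (by linarith)] at this
    linarith
  · by_contra hX
    have hX' : E n < X n := lt_of_not_ge hX
    obtain ⟨j, hj⟩ := hsmall (X n - E n) (by linarith)
    linarith [(iter j n).2]


/-! ## §2 The flow: levels, the dual step in level form, signed base gaps, window gaps -/

variable {B B' : (ℕ → ℝ) → ℝ} {M γ b : ℝ} {S : ℝ → ℕ → ℝ} {h h' : ℕ → ℝ}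

/-- Along a box solution of a functional with floor `b` the level grows by at least `b` per scale, FROM THE PIN: `1∕q² + m·b ≤ 1∕h_m²`. [folklore] -/
theorem level_ge_pin_add (hlo : ∀ u, SeqBox γ u → b ≤ B u) (hh : SeqBox γ h) {q : ℝ} (hf : MemFlow B q h) :
    ∀ m : ℕ, 1 / q ^ 2 + (m : ℝ) * b ≤ 1 / h m ^ 2
  | 0 => by simp [hf.1]
  | m + 1 => by
    have ih := level_ge_pin_add hlo hh hf m
    rw [hf.2 m]; push_cast
    linarith [hlo _ (seqBox_shift hh (m + 1))]

/-- THE GRADED BOX: the tail `(h_{n+1+k})_k` of a box solution from a pin in `]0,γ]` has its age-`k` level at least `1∕γ² + (k+1)·b`. [folklore] -/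
theorem tail_graded (hb : 0 < b) (hlo : ∀ u, SeqBox γ u → b ≤ B u) (hh : SeqBox γ h) {q : ℝ} (hq : 0 < q) (hqγ : q ≤ γ)
    (hf : MemFlow B q h) (n k : ℕ) : 1 / γ ^ 2 + ((k : ℝ) + 1) * b ≤ 1 / h (n + 1 + k) ^ 2 := by
  have h1 := level_ge_pin_add hlo hh hf (n + 1 + k)
  have hq2 : 1 / γ ^ 2 ≤ 1 / q ^ 2 := one_div_le_one_div_of_le (pow_pos hq 2) (pow_le_pow_left₀ hq.le hqγ 2)
  push_cast at h1
  nlinarith [h1, hq2, hb]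

/-- THE DUAL STEP IN LEVEL FORM: `B′(h′_{m+1}, …) − B((S h′_m)_1, …) = 1∕h′_{m+1}² − 1∕(S h′_m)_1²` — the perturbed level one scale after the pin `h′_m` minus the
base's level one scale after the same pin (the two recursions). [folklore] -/
theorem dual_step_eq_levels (hS : ∀ p, 0 < p → p ≤ γ → SeqBox γ (S p) ∧ MemFlow B p (S p)) (hh' : SeqBox γ h') {y : ℝ}
    (hf' : MemFlow B' y h') (m : ℕ) :
    B' (fun i => h' (m + 1 + i)) - B (fun i => S (h' m) (1 + i)) = 1 / h' (m + 1) ^ 2 - 1 / S (h' m) 1 ^ 2 := by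
  have hSm := hS (h' m) (hh' m).1 (hh' m).2
  have e1 : 1 / h' (m + 1) ^ 2 = 1 / h' m ^ 2 + B' (fun i => h' (m + 1 + i)) := hf'.2 m
  have e2 : 1 / S (h' m) (0 + 1) ^ 2 = 1 / S (h' m) 0 ^ 2 + B (fun i => S (h' m) (0 + 1 + i)) := hSm.2.2 0
  rw [family_zero hS (hh' m).1 (hh' m).2, show (0 : ℕ) + 1 = 1 from rfl] at e2
  have e3 : (fun i => S (h' m) (0 + 1 + i)) = (fun i => S (h' m) (1 + i)) := by funext i; simp
  rw [e3] at e2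
  rw [e1, e2]; ring

/-- **TWO BASE ORBITS, SIGNED DAMPING.**  Base `B` isotone with floor, modulus, unique box solutions `S q`.  For ANY two pins `q₁, q₂ ∈ ]0,γ]` and every scale `j`
the level gap `1∕(S q₁)_j² − 1∕(S q₂)_j²` lies between `0` and the pin gap `1∕q₁² − 1∕q₂²` (whichever order the pins have): its positive part is at most the
positive part of the pin gap and its negative part at most the negative part (`le_of_pin_le` + `base_gap_damped`, both orders). [folklore] -/
theorem base_level_gap_between (hb : 0 < b)
    (hmono : ∀ u v : ℕ → ℝ, SeqBox γ u → SeqBox γ v → (∀ i, u i ≤ v i) → B u ≤ B v)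
    (hB : ∀ u u' : ℕ → ℝ, SeqBox γ u → SeqBox γ u' → ∀ D : ℝ, (∀ j, |u j - u' j| ≤ D) → |B u - B u'| ≤ M * D) (hM : 0 ≤ M)
    (hlo : ∀ u, SeqBox γ u → b ≤ B u)
    (hS : ∀ p, 0 < p → p ≤ γ → SeqBox γ (S p) ∧ MemFlow B p (S p))
    (huniq : ∀ p, 0 < p → p ≤ γ → ∀ u u' : ℕ → ℝ, SeqBox γ u → SeqBox γ u' → MemFlow B p u → MemFlow B p u' → u = u')
    {q₁ q₂ : ℝ} (hq₁ : 0 < q₁) (hq₁γ : q₁ ≤ γ) (hq₂ : 0 < q₂) (hq₂γ : q₂ ≤ γ) (j : ℕ) :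
    1 / S q₁ j ^ 2 - 1 / S q₂ j ^ 2 ≤ max (1 / q₁ ^ 2 - 1 / q₂ ^ 2) 0
      ∧ -(1 / S q₁ j ^ 2 - 1 / S q₂ j ^ 2) ≤ max (-(1 / q₁ ^ 2 - 1 / q₂ ^ 2)) 0 := by
  have hS1 := hS q₁ hq₁ hq₁γ
  have hS2 := hS q₂ hq₂ hq₂γ
  have hp1 : ∀ i, 0 < S q₁ i := fun i => (hS1.1 i).1
  have hp2 : ∀ i, 0 < S q₂ i := fun i => (hS2.1 i).1
  rcases le_total q₁ q₂ with h12 | h21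
  · have hle : ∀ i, S q₁ i ≤ S q₂ i := fun i =>
      le_of_pin_le hb hB hM hlo huniq hq₁ h12 hq₂γ hS1.1 hS2.1 hS1.2 hS2.2 i
    have hd := base_gap_damped hmono hS2.1 hS2.2 hS1.1 hS1.2 hle j
    have h0 : 0 ≤ 1 / S q₁ j ^ 2 - 1 / S q₂ j ^ 2 :=
      sub_nonneg.mpr (one_div_le_one_div_of_le (pow_pos (hp1 j) 2) (pow_le_pow_left₀ (hp1 j).le (hle j) 2))
    exact ⟨hd.trans (le_max_left _ _), by linarith [le_max_right (-(1 / q₁ ^ 2 - 1 / q₂ ^ 2)) 0]⟩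
  · have hle : ∀ i, S q₂ i ≤ S q₁ i := fun i =>
      le_of_pin_le hb hB hM hlo huniq hq₂ h21 hq₁γ hS2.1 hS1.1 hS2.2 hS1.2 i
    have hd := base_gap_damped hmono hS1.1 hS1.2 hS2.1 hS2.2 hle j
    have h0 : 0 ≤ 1 / S q₂ j ^ 2 - 1 / S q₁ j ^ 2 :=
      sub_nonneg.mpr (one_div_le_one_div_of_le (pow_pos (hp2 j) 2) (pow_le_pow_left₀ (hp2 j).le (hle j) 2))
    exact ⟨by linarith [le_max_right (1 / q₁ ^ 2 - 1 / q₂ ^ 2) 0], by linarith [le_max_left (-(1 / q₁ ^ 2 - 1 / q₂ ^ 2)) 0]⟩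

/-- **THE WINDOW GAPS ARE CONTROLLED BY THE SIGNED PARTS OF THE DUAL STEPS — NO SIGN ASSUMED.**  `h′` ANY box sequence (its points serve as pins), base family `S`.
With the dual steps in level form `X_m = 1∕h′_{m+1}² − 1∕(S h′_m)_1²`, the age-`k` window gap above the pin `h′_n`,
`1∕h′_{n+1+k}² − 1∕(S h′_n)_{1+k}²`, is at most `Σ_{l≤k} X⁺_{n+l}` and at least `−Σ_{l≤k} X⁻_{n+l}`: telescope through the base orbits restarted at the intermediate
points (autonomy `family_tail_eq`) and damp each pin gap `X_{n+l}` by `base_level_gap_between`.  ((E132) `dual_gap_le_sum_steps` is the case `X ≥ 0`.) [folklore] -/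
theorem gap_le_sum_parts (hb : 0 < b)
    (hmono : ∀ u v : ℕ → ℝ, SeqBox γ u → SeqBox γ v → (∀ i, u i ≤ v i) → B u ≤ B v)
    (hB : ∀ u u' : ℕ → ℝ, SeqBox γ u → SeqBox γ u' → ∀ D : ℝ, (∀ j, |u j - u' j| ≤ D) → |B u - B u'| ≤ M * D) (hM : 0 ≤ M)
    (hlo : ∀ u, SeqBox γ u → b ≤ B u)
    (hS : ∀ p, 0 < p → p ≤ γ → SeqBox γ (S p) ∧ MemFlow B p (S p))
    (huniq : ∀ p, 0 < p → p ≤ γ → ∀ u u' : ℕ → ℝ, SeqBox γ u → SeqBox γ u' → MemFlow B p u → MemFlow B p u' → u = u')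
    (hh' : SeqBox γ h') :
    ∀ k n : ℕ, 1 / h' (n + 1 + k) ^ 2 - 1 / S (h' n) (1 + k) ^ 2
          ≤ ∑ l ∈ range (k + 1), max (1 / h' (n + l + 1) ^ 2 - 1 / S (h' (n + l)) 1 ^ 2) 0
      ∧ -(1 / h' (n + 1 + k) ^ 2 - 1 / S (h' n) (1 + k) ^ 2)
          ≤ ∑ l ∈ range (k + 1), max (-(1 / h' (n + l + 1) ^ 2 - 1 / S (h' (n + l)) 1 ^ 2)) 0 := by
  intro k
  induction k with
  | zero =>
    intro n
    simp only [add_zero, zero_add, sum_range_one]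
    exact ⟨le_max_left _ _, le_max_left _ _⟩
  | succ k ih =>
    intro n
    have hpn : 0 < h' n := (hh' n).1
    have hpnγ : h' n ≤ γ := (hh' n).2
    have hq1 : 0 < h' (n + 1) := (hh' (n + 1)).1
    have hq1γ : h' (n + 1) ≤ γ := (hh' (n + 1)).2
    have hq2m := family_mem hS hpn hpnγ 1
    -- autonomy: the base orbit from h′_n beyond scale 1 is the base orbit from (S h′_n)_1
    have e2 : S (h' n) (1 + (k + 1)) = S (S (h' n) 1) (1 + k) := by
      have := congrFun (family_tail_eq hS huniq hpn hpnγ 1) (1 + k)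
      simpa [Nat.add_comm, Nat.add_assoc] using this
    have e1 : n + 1 + (k + 1) = (n + 1) + 1 + k := by omega
    obtain ⟨ihP, ihN⟩ := ih (n + 1)
    obtain ⟨dP, dN⟩ := base_level_gap_between hb hmono hB hM hlo hS huniq hq1 hq1γ hq2m.1 hq2m.2 (1 + k)
    have er : ∀ l : ℕ, n + (l + 1) = n + 1 + l := fun l => by omega
    have hreP : ∑ l ∈ range (k + 1), max (1 / h' (n + (l + 1) + 1) ^ 2 - 1 / S (h' (n + (l + 1))) 1 ^ 2) 0
        = ∑ l ∈ range (k + 1), max (1 / h' (n + 1 + l + 1) ^ 2 - 1 / S (h' (n + 1 + l)) 1 ^ 2) 0 :=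
      sum_congr rfl fun l _ => by rw [er l]
    have hreN : ∑ l ∈ range (k + 1), max (-(1 / h' (n + (l + 1) + 1) ^ 2 - 1 / S (h' (n + (l + 1))) 1 ^ 2)) 0
        = ∑ l ∈ range (k + 1), max (-(1 / h' (n + 1 + l + 1) ^ 2 - 1 / S (h' (n + 1 + l)) 1 ^ 2)) 0 :=
      sum_congr rfl fun l _ => by rw [er l]
    rw [e1, e2]
    constructor
    · rw [sum_range_succ', add_zero, hreP]; linarith
    · rw [sum_range_succ', add_zero, hreN]; linarith

end Summit.QuantumFields.BalabanUV.Beta.EriceRemainderEnclosureHistoryAutonomyComparisonDualContractionLinks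

end
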